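import Summits.BirchSwinnertonDyer.BirchSwinnertonDyer.Theorems.AdditiveKolyvaginRoadKummerDescentSplitPrime
import Summits.BirchSwinnertonDyer.BirchSwinnertonDyer.Theorems.AdditiveKolyvaginRoadKummerDescentSchur
import Summits.BirchSwinnertonDyer.BirchSwinnertonDyer.Theorems.AdditiveKolyvaginRoadLagrangianSwitchAtPParity
import Summits.BirchSwinnertonDyer.BirchSwinnertonDyer.Theorems.AdditiveKolyvaginRoadLevelDefs
import Literature.NumberTheory.EllipticCurves.OpenImageMazurAssemblyProofs
import Literature.NumberTheory.EllipticCurves.NonEisensteinPrimeOfSurjective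
import Literature.NumberTheory.EllipticCurves.TamagawaSubgroupProofs
import Literature.NumberTheory.EllipticCurves.StrictSelmerTorsionLevelUniformBound
import Literature.NumberTheory.EllipticCurves.BSDSelmerCMPConverseRankOneProofs
import HarnessLib

/-!
# Route `AdditiveKolyvaginRoad`, crux `LevelKolyvaginSystemsAdditive` (item stmt-BirchSwinnertonDyer-21396, KS′):
# registered stub `stub_kummerLineAtP` (S4 = (θK)ₚ, THE ε-MATCHING) of line `epsilon_matched_retyping`, PROVED
# (cell `pub/bsd-wall`, width seats `bsd-wall-akr-p2x-w2` g3 (ℚ-half) + g4 (K-half); `--supports stmt-BirchSwinnertonDyer-21396`;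
# namespace `…Theorems.AdditiveKoly`)

WHY. The transfer socket of line `epsilon_matched_retyping` borrows W. Zhang's level system from an ε-matched `p`-good avatar `E₀`
along `E[p] ≅ E₀[p]`; at the primes `v ∣ p` of the Heegner field `K` (`p` split) it needs the binder (θK)ₚ: a GLOBAL class
`y ∈ H¹(K, E₀[p])` satisfies E₀'s local Selmer condition at `K_v` iff `θ_* y` satisfies E's, for every `Γ_K`-equivariant
`θ : E₀[p](K̄) ≃ E[p](K̄)`. ASSEMBLY of the two halves:
* ℚ-HALF (w2 g3, p601209 `LagrangianSwitchAtP.map_kummer_eq_kummer_rat_of_p_parity`): in the PLANE `H¹(ℚ_u, E[p])` (`E₀` good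
  non-anomalous at `p`) E's Kummer LINE equals the transport of E₀'s — the one-place Lagrangian switch over `ℚ` would otherwise
  change `dim Sel_p` by one, against `p`-parity (Dokchitser–Dokchitser) ×2 + Cassels–Tate evenness + `w(E) = w(E₀)`;
* K-HALF (this seat, p607822/p608366/p608765 `KummerDescent{BaseField,Transfer,SplitPrime}`): `ℚ_u` is a `K`-field for `v` of
  degree one and the identity descends to `K_v` for the transferred `θ_e = T_E ∘ e⁻¹ ∘ T_{E₀}⁻¹`, with no comparison of absolute
  Galois groups; plus SCHUR (p608995 `KummerDescentSchur`): under `ρ̄_{E,p}` onto, `[K : ℚ] = 2`, `p` odd, any `Γ_K`-equivariant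
  `θ` is `a · θ_e` with `p ∤ a`, and `a ·` preserves membership in a subgroup of the `p`-torsion group `H¹(K, E[p])`.

WHAT. §1 helpers (`KummerDescent.…`): `h1Equiv_eq_nsmul_h1Equiv`
(`h1Equiv θ = a • h1Equiv θ'` when `θ = a • θ'`), `nsmul_mem_iff_of_not_dvd`, `hasSurjectiveModNGaloisRep_pow_one`,
`exists_nsmul_eq_of_equivariant` (Schur applied: `θ = a • θ_e`, `p ∤ a`). §2 **`stub_kummerLineAtP`** — VERBATIM registered
signature.

HONEST FRAMING: theorems only; 0 definitions, 0 named facts, 0 `sorry`; CONDITIONAL exactly as the stub is stated (named facts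
`p_parity` ×2, `exists_casselsTate_pairing (K := ℚ)`, `poitouTate_selmerStructure_duality ℚ` are HYPOTHESES of the stub, supplied
by the line's PUB stub). Closes ONE E-side stub of the line; the line's open content (S₀ lender system = Zhang 2014 vendoring,
S1 off-locus residual, the per-frame certificate) is untouched. BSD is not proved by any of this.

References: [cite: DokchitserDokchitserAnnals2010, Thm. 1.4] [cite: MilneADT2006, Ch. I Cor. 2.3, Thm. 4.10, §6]
[cite: PoonenRains2012, Prop. 4.10–4.11] [cite: SerreGaloisCohomology1997, I §2.4, II §1.1] [cite: Serre1972, §4]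
[cite: CasselsFrohlichANT1967, Ch. II §10 Theorem (10.2)] [cite: SilvermanAEC2009, III.§7, X.§4].
-/

-- single-conjunct summit: `Summit.BirchSwinnertonDyer.BirchSwinnertonDyer.…` repeats the name by design
set_option linter.dupNamespace false
set_option autoImplicit false

noncomputable section

open scoped Classical NumberField

namespace Summit.BirchSwinnertonDyer.BirchSwinnertonDyer.Theorems.AdditiveKoly

open WeierstrassCurve NumberField IsDedekindDomain Field
  Literature.NumberTheory.EllipticCurves Literature.NumberTheory.GaloisRepresentations
  Literature.NumberTheory.GaloisCohomology
open scoped ContRepresentation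

namespace KummerDescent

/-! ## §1 Helpers -/

section H1

universe u

variable {K : Type u} [Field K] (X X₀ : WeierstrassCurve K) {n : ℤ}

/-- **`h1Equiv θ = a • h1Equiv θ'` when `θ = a • θ'` pointwise** (both are the class of `σ ↦ θ (f σ)` on a cocycle `f`).
[cite: SerreGaloisCohomology1997, I §2.2] -/
theorem h1Equiv_eq_nsmul_h1Equiv (θ θ' : geomTorsion X₀ n ≃+ geomTorsion X n)
    (hθ : ∀ (g : absoluteGaloisGroup K) (P : geomTorsion X₀ n), θ (g • P) = g • θ P)
    (hθ' : ∀ (g : absoluteGaloisGroup K) (P : geomTorsion X₀ n), θ' (g • P) = g • θ' P)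
    (a : ℕ) (h : ∀ R, θ R = a • θ' R) (c : galH1Torsion X₀ n) :
    h1Equiv θ hθ c = a • h1Equiv θ' hθ' c := by
  obtain ⟨f, rfl⟩ := oneCocycleClass_surjective _ c
  rw [h1Equiv_oneCocycleClass X X₀ θ hθ f, h1Equiv_oneCocycleClass X X₀ θ' hθ' f]
  have hf : contOneCocycles.pullback (ContinuousMonoidHom.id (absoluteGaloisGroup K))
        (resHomOfEquivariant (ContinuousMonoidHom.id (absoluteGaloisGroup K)) (θ : geomTorsion X₀ n →+ geomTorsion X n) hθ) f =
      a • contOneCocycles.pullback (ContinuousMonoidHom.id (absoluteGaloisGroup K))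
        (resHomOfEquivariant (ContinuousMonoidHom.id (absoluteGaloisGroup K)) (θ' : geomTorsion X₀ n →+ geomTorsion X n) hθ')
          f := by
    refine Subtype.ext (ContinuousMap.ext fun σ ↦ ?_)
    change θ (f.1 σ) = a • θ' (f.1 σ)
    exact h (f.1 σ)
  rw [hf]
  exact map_nsmul (oneCocycleClassₗ _) a _

end H1

/-- **`a • z ∈ S ↔ z ∈ S`** for a subgroup `S` of an abelian group, an element `z` killed by the prime `p` and `p ∤ a` (`a` is
invertible modulo `p`). [folklore] -/
theorem nsmul_mem_iff_of_not_dvd {A : Type*} [AddCommGroup A] (S : AddSubgroup A) {p a : ℕ} (hp : p.Prime)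
    (ha : ¬ p ∣ a) (z : A) (hz : p • z = 0) : a • z ∈ S ↔ z ∈ S := by
  refine ⟨fun h ↦ ?_, fun h ↦ S.nsmul_mem h a⟩
  obtain ⟨b, -, hb⟩ := Nat.exists_mul_mod_eq_one_of_coprime ((Nat.Prime.coprime_iff_not_dvd hp).mpr ha).symm hp.one_lt
  have hz' : z = b • (a • z) := by
    rw [smul_smul, mul_comm b a, ← Nat.div_add_mod (a * b) p, hb, add_nsmul, one_nsmul, mul_comm p, mul_nsmul', hz,
      nsmul_zero, zero_add]
  rw [hz']
  exact S.nsmul_mem h b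

/-- Surjectivity of `ρ̄` does not depend on the spelling `p` vs `p ^ 1` of the level. [folklore] -/
theorem hasSurjectiveModNGaloisRep_pow_one (X : WeierstrassCurve ℚ) (p : ℕ) (hs : X.HasSurjectiveModNGaloisRep p) :
    X.HasSurjectiveModNGaloisRep ((p ^ 1 : ℕ) : ℤ) := by
  rw [pow_one]
  exact hs

/-- **Schur, applied: any `Γ_K`-equivariant `θ : (W₀ ⊗ K)[n](K̄) ≃ (W ⊗ K)[n](K̄)` is `a • θ'` with `p ∤ a`** for any other such `θ'`,
when `ρ̄_{W,n} : Γ_ℚ ↠ Aut(W[n])` (`n = p¹`, `p` odd) and `[K : ℚ] = 2`: the automorphism `T⁻¹ θ θ'⁻¹ T` of `W[n](ℚ̄)` (`T` the torsion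
transfer, equivariant along `Γ_K → Γ_ℚ`) commutes with `res(Γ_K)`, hence is a scalar `a` (`exists_forall_eq_smul_of_resGal_comm`);
`p ∤ a` since `θ` is injective on the non-zero group `(W₀ ⊗ K)[n]`. [cite: Serre1972, §4] [cite: SerreGaloisCohomology1997, II §1.1] -/
theorem exists_nsmul_eq_of_equivariant (K : Type) [Field K] [NumberField K] (hK2 : Module.finrank ℚ K = 2)
    (W W₀ : WeierstrassCurve ℚ) [W.IsElliptic] [(W₀.baseChange K).IsElliptic] (p : ℕ) [Fact p.Prime] (hp2 : p ≠ 2)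
    (hs : W.HasSurjectiveModNGaloisRep ((p ^ 1 : ℕ) : ℤ)) (hn : ((p ^ 1 : ℕ) : ℤ) ≠ 0)
    (θ θ' : geomTorsion (W₀.baseChange K) ((p ^ 1 : ℕ) : ℤ) ≃+ geomTorsion (W.baseChange K) ((p ^ 1 : ℕ) : ℤ))
    (hθ : ∀ (g : absoluteGaloisGroup K) (P : geomTorsion (W₀.baseChange K) ((p ^ 1 : ℕ) : ℤ)), θ (g • P) = g • θ P)
    (hθ' : ∀ (g : absoluteGaloisGroup K) (P : geomTorsion (W₀.baseChange K) ((p ^ 1 : ℕ) : ℤ)), θ' (g • P) = g • θ' P) :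
    ∃ a : ℕ, ¬ p ∣ a ∧ ∀ R, θ R = a • θ' R := by
  have hp : p.Prime := Fact.out
  set T := W.torsionTransferEquiv (E := K) hn with hT
  -- the automorphism `T⁻¹ θ θ'⁻¹ T` of `W[n](ℚ̄)` commutes with `res(Γ_K)`
  let αE : geomTorsion W ((p ^ 1 : ℕ) : ℤ) ≃+ geomTorsion W ((p ^ 1 : ℕ) : ℤ) :=
    T.trans (θ'.symm.trans (θ.trans T.symm))
  have hαE : ∀ P, αE P = T.symm (θ (θ'.symm (T P))) := fun _ ↦ rfl
  have hcomm : ∀ (τ : absoluteGaloisGroup K) (P : geomTorsion W ((p ^ 1 : ℕ) : ℤ)),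
      αE.toAddMonoidHom (resGal (K := ℚ) K τ • P) = resGal (K := ℚ) K τ • αE.toAddMonoidHom P := by
    intro τ P
    change αE _ = _ • αE P
    rw [hαE, hαE, resGal_eq_absGaloisRestrict, torsionTransferEquiv_smul, symm_equivariant θ' hθ', hθ,
      torsionTransferEquiv_symm_smul]
  have htors : ∀ x : geomTorsion W ((p ^ 1 : ℕ) : ℤ), p • x = 0 := fun x ↦ by
    apply Subtype.ext
    rw [AddSubmonoidClass.coe_nsmul, ZeroMemClass.coe_zero]
    simpa only [pow_one] using AddSubgroup.torsionBy.nsmul_iff.mp x.2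
  obtain ⟨a, ha⟩ := exists_forall_eq_smul_of_resGal_comm K W hK2 hp2 ((p ^ 1 : ℕ) : ℤ) hs htors αE.toAddMonoidHom hcomm
  have key : ∀ R, θ R = a • θ' R := fun R ↦ by
    have h1 := ha (T.symm (θ' R))
    change αE _ = _ at h1
    rw [hαE, AddEquiv.apply_symm_apply, AddEquiv.symm_apply_apply, ← map_nsmul] at h1
    exact T.symm.injective h1
  refine ⟨a, fun hpa ↦ ?_, key⟩
  -- `p ∣ a` would make `θ = 0` on the non-zero group `(W₀ ⊗ K)[n]`
  haveI : CharZero K := inferInstance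
  have hcard : Nat.card (geomTorsion (W₀.baseChange K) ((p ^ 1 : ℕ) : ℤ)) = (p ^ 1) ^ 2 :=
    WeierstrassCurve.card_torsionPoints_eq_sq_holds (W₀.baseChange K) (AlgebraicClosure K) (n := p ^ 1)
      (by exact_mod_cast pow_ne_zero 1 hp.ne_zero)
  have hnt : ∃ R : geomTorsion (W₀.baseChange K) ((p ^ 1 : ℕ) : ℤ), R ≠ 0 := by
    by_contra hall
    have hsub : Subsingleton (geomTorsion (W₀.baseChange K) ((p ^ 1 : ℕ) : ℤ)) :=
      ⟨fun x y ↦ by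
        have hx : x = 0 := by_contra fun hx ↦ hall ⟨x, hx⟩
        have hy : y = 0 := by_contra fun hy ↦ hall ⟨y, hy⟩
        rw [hx, hy]⟩
    have h1 : Nat.card (geomTorsion (W₀.baseChange K) ((p ^ 1 : ℕ) : ℤ)) = 1 :=
      Nat.card_eq_one_iff_unique.mpr ⟨hsub, ⟨0⟩⟩
    rw [hcard, pow_one] at h1
    have h2 : p * p = 1 := by rw [← sq]; exact h1
    exact hp.one_lt.ne' (Nat.eq_one_of_mul_eq_one_right h2)
  obtain ⟨R, hR⟩ := hnt
  apply hR
  apply θ.injective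
  obtain ⟨k, rfl⟩ := hpa
  have hzero : (p * k) • θ' R = 0 := by
    rw [mul_comm, mul_nsmul']
    have h0 : p • θ' R = 0 := by
      apply Subtype.ext
      rw [AddSubmonoidClass.coe_nsmul, ZeroMemClass.coe_zero]
      simpa only [pow_one] using AddSubgroup.torsionBy.nsmul_iff.mp (θ' R).2
    rw [h0, nsmul_zero]
  rw [key, hzero, map_zero]

end KummerDescent

/-! ## §2 The registered stub -/

-- the registered signature carries `hrad` (used by the line only through (Tam)); keep it verbatim
set_option linter.unusedVariables false in
/-- **`stub_kummerLineAtP` — registered stub (θK)ₚ of line `epsilon_matched_retyping` (skeleton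
`Cruxes/LevelKolyvaginSystemsAdditive/Lines/epsilon_matched_retyping.lean`), VERBATIM signature, PROVED.** At a prime `v ∣ p` of the
imaginary quadratic field `K` in which `p` splits, for EVERY `Γ_K`-equivariant isomorphism `θ : E₀[p](K̄) ≃ E[p](K̄)` and every global
class `y ∈ H¹(K, E₀[p])`: `θ_* y` satisfies E's local Selmer condition at `K_v` iff `y` satisfies E₀'s. ℚ-half: in the plane
`H¹(ℚ_u, E[p])` (`#` = `p²`: `E₀` good non-anomalous at `p`) E's Kummer line is the transport of E₀'s, since the two Kummer Selmer
structures agree off `p` (`p ∤ c_u(E) c_u(E₀)` from `p ∤ ∏ c`) and a one-place Lagrangian switch over `ℚ` would change `dim Sel_p` by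
one against `p`-parity ×2, Cassels–Tate evenness, `E(ℚ)[p] = E₀(ℚ)[p] = 0` (`ρ̄` onto) and `w(E) = w(E₀)` — w2 g3's
`map_kummer_eq_kummer_rat_of_p_parity` (p601209); K-half: `ℚ_u` is a `K`-field at the degree-one `v` and the identity descends for
the transferred `θ_e` (`KummerDescent.h1Equiv_torsionTransfer_mem_selmerLocalKer_iff_of_map_kummer_eq`, p608765), and every `θ` is
`a · θ_e`, `p ∤ a` (Schur, `KummerDescent.exists_nsmul_eq_of_equivariant`). Feeds the binder `hKumP` of the line's composition.
[cite: DokchitserDokchitserAnnals2010, Thm. 1.4] [cite: MilneADT2006, Ch. I Cor. 2.3, Thm. 4.10] [cite: PoonenRains2012, Prop. 4.10–4.11]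
[cite: SerreGaloisCohomology1997, I §2.4, II §1.1] [cite: CasselsFrohlichANT1967, Ch. II §10 Theorem (10.2)] -/
theorem stub_kummerLineAtP (W W₀ : WeierstrassCurve ℚ) [W.IsElliptic] [W.IsGloballyMinimal] [W₀.IsElliptic]
    [W₀.IsGloballyMinimal] (p : ℕ) [Fact p.Prime] (K : Type) [Field K] [NumberField K]
    (hparW : p_parity W p) (hparW₀ : p_parity W₀ p) (hCT : WeierstrassCurve.exists_casselsTate_pairing (K := ℚ))
    (hPT : poitouTate_selmerStructure_duality ℚ) (hp : 5 ≤ p) (hs : W.HasSurjectiveModNGaloisRep p)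
    (htam : ¬ p ∣ W.tamagawaProduct) (htam₀ : ¬ p ∣ W₀.tamagawaProduct)
    (hrad : ∀ q : ℕ, q.Prime → (q ∣ p * W.conductorNorm ℤ ↔ q ∣ p * W₀.conductorNorm ℤ))
    (hgood₀ : W₀.HasGoodReductionAtPrime p) (hna : ¬ (p : ℤ) ∣ W₀.frobeniusTrace p - 1)
    (hroot : W₀.rootNumber = W.rootNumber) (hK : IsImaginaryQuadratic K)
    (hsplit : ((Ideal.span {(p : ℤ)}).primesOver (𝓞 K)).ncard = 2)
    (e : geomTorsion W (p : ℤ) ≃+ geomTorsion W₀ (p : ℤ))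
    (he : ∀ (σ : absoluteGaloisGroup ℚ) (P : geomTorsion W (p : ℤ)), e (σ • P) = σ • e P)
    (θ : geomTorsion (W₀.baseChange K) ((p ^ 1 : ℕ) : ℤ) ≃+ geomTorsion (W.baseChange K) ((p ^ 1 : ℕ) : ℤ))
    (hθ : ∀ (g : absoluteGaloisGroup K) (P : geomTorsion (W₀.baseChange K) ((p ^ 1 : ℕ) : ℤ)), θ (g • P) = g • θ P)
    (v : HeightOneSpectrum (𝓞 K)) (hvp : (p : 𝓞 K) ∈ v.asIdeal) (y : Vp W₀ K p) :
    h1Equiv θ hθ y ∈ selmerLocalKer (W.baseChange K) (v.adicCompletion K) ((p ^ 1 : ℕ) : ℤ) ↔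
      y ∈ selmerLocalKer (W₀.baseChange K) (v.adicCompletion K) ((p ^ 1 : ℕ) : ℤ) := by
  have hp' : p.Prime := Fact.out
  have hp2 : p ≠ 2 := by omega
  have hp3 : 3 ≤ p := by omega
  have hn : ((p ^ 1 : ℕ) : ℤ) ≠ 0 := by exact_mod_cast pow_ne_zero 1 hp'.ne_zero
  have hlev : ((p ^ 1 : ℕ) : ℤ) = (p : ℤ) := by simp
  haveI : (W.baseChange K).IsElliptic := inferInstanceAs (W.map (algebraMap ℚ K)).IsElliptic
  haveI : (W₀.baseChange K).IsElliptic := inferInstanceAs (W₀.map (algebraMap ℚ K)).IsElliptic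
  haveI : NeZero (p : ℚ) := ⟨Nat.cast_ne_zero.mpr hp'.ne_zero⟩
  -- the torsion isomorphism at level `p ^ 1`, in the direction `E₀ → E`
  let eW : geomTorsion W ((p ^ 1 : ℕ) : ℤ) ≃+ geomTorsion W (p : ℤ) := AddEquiv.addSubgroupCongr (by rw [hlev])
  let eW₀ : geomTorsion W₀ ((p ^ 1 : ℕ) : ℤ) ≃+ geomTorsion W₀ (p : ℤ) := AddEquiv.addSubgroupCongr (by rw [hlev])
  let e₁ : geomTorsion W ((p ^ 1 : ℕ) : ℤ) ≃+ geomTorsion W₀ ((p ^ 1 : ℕ) : ℤ) := eW.trans (e.trans eW₀.symm)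
  have he₁ : ∀ (σ : absoluteGaloisGroup ℚ) (x : geomTorsion W ((p ^ 1 : ℕ) : ℤ)), e₁ (σ • x) = σ • e₁ x := by
    intro σ x
    have h1 : eW (σ • x) = σ • eW x := Subtype.ext rfl
    apply Subtype.ext
    change ((e (eW (σ • x)) : geomTorsion W₀ (p : ℤ)) : geomPoints W₀) = ((σ • eW₀.symm (e (eW x)) : _) : geomPoints W₀)
    rw [h1, he]
    rfl
  let e' : geomTorsion W₀ ((p ^ 1 : ℕ) : ℤ) ≃+ geomTorsion W ((p ^ 1 : ℕ) : ℤ) := e₁.symm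
  have he' : ∀ (σ : absoluteGaloisGroup ℚ) (y : geomTorsion W₀ ((p ^ 1 : ℕ) : ℤ)), e' (σ • y) = σ • e' y :=
    symm_equivariant e₁ he₁
  -- the intertwining maps of `e'`
  obtain ⟨φ, ψ, hφ, -, hψφ, hφψ, -⟩ := KummerDescent.exists_intertwining_of_addEquiv W W₀ ((p ^ 1 : ℕ) : ℤ) e' he'
  -- the ℚ-HALF at `u = v ∩ ℚ` (w2 g3)
  set u : HeightOneSpectrum (𝓞 ℚ) := v.under (𝓞 ℚ) with hu_def
  have hu : ((p : ℕ) : 𝓞 ℚ) ∈ u.asIdeal := SplitCompletion.natCast_mem_under K p v hvp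
  have hirr : W.HasIrreducibleModPGaloisRep p := hasIrreducibleModPGaloisRep_of_hasSurjectiveModNGaloisRep W p hs
  have hirr₀ : W₀.HasIrreducibleModPGaloisRep p := Mazur1978.hasIrreducibleModPGaloisRep_of_addEquiv e he hirr
  have htors : Nat.card (AddSubgroup.torsionBy W.toAffine.Point ((p ^ 1 : ℕ) : ℤ)) = 1 := by
    rw [hlev]; exact natCard_torsionBy_eq_one_of_hasIrreducibleModPGaloisRep W p hirr
  have htors₀ : Nat.card (AddSubgroup.torsionBy W₀.toAffine.Point ((p ^ 1 : ℕ) : ℤ)) = 1 := by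
    rw [hlev]; exact natCard_torsionBy_eq_one_of_hasIrreducibleModPGaloisRep W₀ p hirr₀
  have htam' : ∀ u' : HeightOneSpectrum (𝓞 ℚ), u' ≠ u → (¬ W.HasGoodReductionAt u' ∨ ¬ W₀.HasGoodReductionAt u') →
      ¬ p ∣ (W.baseChange (u'.adicCompletion ℚ)).localTamagawaNumber (u'.adicCompletionIntegers ℚ) ∧
      ¬ p ∣ (W₀.baseChange (u'.adicCompletion ℚ)).localTamagawaNumber (u'.adicCompletionIntegers ℚ) :=
    fun u' _ _ ↦ ⟨fun h ↦ htam (h.trans (finprod_mem_dvd u' W.mulSupport_localTamagawaNumber_finite_holds)),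
      fun h ↦ htam₀ (h.trans (finprod_mem_dvd u' W₀.mulSupport_localTamagawaNumber_finite_holds))⟩
  have hrat := LagrangianSwitchAtP.map_kummer_eq_kummer_rat_of_p_parity W W₀ p φ ψ hψφ hφψ hp3 hPT hCT hparW hparW₀ hroot.symm
    htors htors₀ u hu hgood₀ hna htam'
  -- the K-HALF for the transferred isomorphism `θ_e = T_E ∘ e' ∘ T_{E₀}⁻¹`
  have hcan := KummerDescent.h1Equiv_torsionTransfer_mem_selmerLocalKer_iff_of_map_kummer_eq W W₀ p K hK.1 hsplit hn e' he'
    φ hφ v hvp hrat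
  -- SCHUR: `θ = a • θ_e`, `p ∤ a`
  obtain ⟨a, hpa, hθa⟩ := KummerDescent.exists_nsmul_eq_of_equivariant K hK.1 W W₀ p hp2
    (KummerDescent.hasSurjectiveModNGaloisRep_pow_one W p hs) hn θ
    (((W₀.torsionTransferEquiv (E := K) hn).symm.trans e').trans (W.torsionTransferEquiv (E := K) hn)) hθ
    (KummerDescent.torsionTransfer_conj_smul W W₀ hn e' he')
  have hpy : p • h1Equiv (((W₀.torsionTransferEquiv (E := K) hn).symm.trans e').trans (W.torsionTransferEquiv (E := K) hn))
      (KummerDescent.torsionTransfer_conj_smul W W₀ hn e' he') y = 0 := by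
    have h := nsmul_galH1Torsion_natCast_eq_zero (W.baseChange K) (p ^ 1)
      (h1Equiv (((W₀.torsionTransferEquiv (E := K) hn).symm.trans e').trans (W.torsionTransferEquiv (E := K) hn))
        (KummerDescent.torsionTransfer_conj_smul W W₀ hn e' he') y)
    simpa only [pow_one] using h
  rw [KummerDescent.h1Equiv_eq_nsmul_h1Equiv (W.baseChange K) (W₀.baseChange K) θ _ hθ
      (KummerDescent.torsionTransfer_conj_smul W W₀ hn e' he') a hθa y,
    KummerDescent.nsmul_mem_iff_of_not_dvd _ hp' hpa _ hpy]
  exact hcan y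

end Summit.BirchSwinnertonDyer.BirchSwinnertonDyer.Theorems.AdditiveKoly

end
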